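import Summits.Ventures.PercRepro.GenQHyperplaneFlow

/-!
# PercRepro — the rises of the profile are counted by the hyperplane traces (night-4, gen 7)

The profile row (L4) of night-2 («weighted rises») says that each coloop of a level-`(k+1)` set `S′` is lost in
`S′ ∪ y` for at least one `y ∈ G ∖ S′`.  The EXACT count is the row (H5) of the hyperplane-trace block (sheet §62
(k4″)): a coloop `x` of `S′` is lost exactly for the points of `G ∖ S′` outside its hyperplane `cl(S′ ∖ x)` — and
`S′` has exactly one point (`x`) outside that hyperplane — so

`Σ_{S′ ∈ R_q(G), |G ∖ S′| = k} Σ_{y ∈ G ∖ S′} (m(S′) − m(S′ ∪ y))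
  = Σ_{H ∈ flatsQ (q−1)} |G ∖ H|·(|G ∖ H| − 1)·#{T ⊆ H ∩ G : |T| = |G| − k − 1, rk T = q − 1}`

(`sum_rises_eq_sum_hyperplanes`), through `coloopsOf_insert_eq` (the coloops of `S′ ∪ y` are the coloops `x` of
`S′` with `y ∈ cl(S′ ∖ x)`) and the weighted form of (H1)'s bijection (`sum_coloops_weight_eq_sum_hyperplanes`);
and the STAYS: `m(S ∪ y) = m(S)` iff `y` lies in the closure of the cyclic part `S ∖ coloops` (`mTr_insert_eq_iff`),
so the stays of `S` number `|cl(Z) ∩ G| − |Z|` (`card_stays_eq`) — the two-sided «stay» row night-4 gen 5 lacked.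
Imports `GenQHyperplaneFlow`.
-/
namespace PercRepro.Night4

open Finset ThmH SixFour GenQ PerFlat Star

variable {α : Type*} [DecidableEq α] {M : Matroid α} [M.Finite]

/-! ## (H5) the rises: each coloop `x` of `S′` is lost for exactly the `|G ∖ cl(S′ ∖ x)| − 1` points of `G ∖ S′` outside its hyperplane -/

/-- The weighted form of the bijection of (H1): summing `|G ∖ cl(S ∖ x)| − 1` over the coloop pairs `(S, x)` of
level `k` gives `Σ_H |G ∖ H|·(|G ∖ H| − 1)·#{T ⊆ H ∩ G : |T| = |G| − k − 1, rk T = q − 1}`. -/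
theorem sum_coloops_weight_eq_sum_hyperplanes {G : Finset α} {q k : ℕ} (hG : G ⊆ gr M)
    (hq : 1 ≤ q) (hk : k + 1 ≤ G.card) :
    ∑ S ∈ levelSets M G q k, ∑ x ∈ coloopsOf M S, ((G \ clF M (S.erase x)).card - 1)
      = ∑ H ∈ flatsQ M (q - 1), (G \ H).card * ((G \ H).card - 1) * spF M G H (q - 1) (G.card - k - 1) := by
  classical
  have hL : ∑ S ∈ levelSets M G q k, ∑ x ∈ coloopsOf M S, ((G \ clF M (S.erase x)).card - 1)
      = ∑ p ∈ (levelSets M G q k).sigma (fun S => coloopsOf M S), ((G \ clF M (p.1.erase p.2)).card - 1) := by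
    rw [Finset.sum_sigma]
  have hR : ∑ H ∈ flatsQ M (q - 1), (G \ H).card * ((G \ H).card - 1) * spF M G H (q - 1) (G.card - k - 1)
      = ∑ p ∈ (flatsQ M (q - 1)).sigma (fun H => (G \ H) ×ˢ
          ((H ∩ G).powersetCard (G.card - k - 1)).filter
            (fun T : Finset α => M.eRk (T : Set α) = ((q - 1 : ℕ) : ℕ∞))), ((G \ p.1).card - 1) := by
    rw [Finset.sum_sigma]
    refine Finset.sum_congr rfl (fun H _ => ?_)
    simp only [Finset.sum_const, Finset.card_product, smul_eq_mul]
    unfold spF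
    ring
  rw [hL, hR]
  refine Finset.sum_bij' (fun p _ => ⟨clF M (p.1.erase p.2), (p.2, p.1.erase p.2)⟩)
    (fun p _ => ⟨insert p.2.1 p.2.2, p.2.1⟩) ?_ ?_ ?_ ?_ ?_
  · rintro ⟨S, x⟩ hp
    rw [Finset.mem_sigma] at hp
    obtain ⟨hS, hx⟩ := hp
    have hS' := mem_levelSets.1 hS
    have hSR := mem_Rq.1 hS'.1
    have hx' := mem_coloopsOf.1 hx
    rw [Finset.mem_sigma]
    refine ⟨clF_erase_mem_flatsQ_of_mem_coloopsOf hG hS'.1 hx, ?_⟩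
    rw [Finset.mem_product]
    refine ⟨?_, ?_⟩
    · rw [Finset.mem_sdiff]
      refine ⟨hSR.1 hx'.1, ?_⟩
      rw [mem_clF]
      exact hx'.2
    · rw [Finset.mem_filter, Finset.mem_powersetCard]
      refine ⟨⟨?_, ?_⟩, eRk_erase_of_mem_coloopsOf hG hS'.1 hx⟩
      · intro y hy
        rw [Finset.mem_inter]
        refine ⟨?_, hSR.1 (Finset.erase_subset x S hy)⟩
        rw [mem_clF]
        refine M.subset_closure _ ?_ (Finset.mem_coe.2 hy)
        rw [← coe_gr M]
        exact Finset.coe_subset.2 ((Finset.erase_subset x S).trans (hSR.1.trans hG))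
      · rw [Finset.card_erase_of_mem hx'.1]
        have h1 := Finset.card_sdiff_of_subset hSR.1
        have h2 := Finset.card_le_card hSR.1
        omega
  · rintro ⟨H, x, T⟩ hp
    rw [Finset.mem_sigma, Finset.mem_product, Finset.mem_sdiff, Finset.mem_filter,
      Finset.mem_powersetCard] at hp
    obtain ⟨hH, ⟨hxG, hxH⟩, ⟨hTHG, hTcard⟩, hrT⟩ := hp
    have hTH : T ⊆ H := hTHG.trans Finset.inter_subset_left
    have hTG : T ⊆ G := hTHG.trans Finset.inter_subset_right
    have hmain := insert_mem_Rq_of_flat hG hH hTH hTG hrT hq hxG hxH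
    rw [Finset.mem_sigma]
    refine ⟨mem_levelSets.2 ⟨hmain.1, ?_⟩, hmain.2⟩
    have hxT : x ∉ T := fun h => hxH (hTH h)
    rw [Finset.card_sdiff_of_subset (Finset.insert_subset hxG hTG), Finset.card_insert_of_notMem hxT, hTcard]
    omega
  · rintro ⟨S, x⟩ hp
    rw [Finset.mem_sigma] at hp
    have hx' := mem_coloopsOf.1 hp.2
    exact Sigma.ext (Finset.insert_erase hx'.1) HEq.rfl
  · rintro ⟨H, x, T⟩ hp
    rw [Finset.mem_sigma, Finset.mem_product, Finset.mem_sdiff, Finset.mem_filter,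
      Finset.mem_powersetCard] at hp
    obtain ⟨hH, ⟨hxG, hxH⟩, ⟨hTHG, _⟩, hrT⟩ := hp
    have hH' := mem_flatsQ.1 hH
    have hTH : T ⊆ H := hTHG.trans Finset.inter_subset_left
    have hxT : x ∉ T := fun h => hxH (hTH h)
    have hcl : clF M T = H := by
      apply Finset.coe_injective
      rw [coe_clF]
      have h1 : M.closure (T : Set α) = M.closure (H : Set α) :=
        (M.isRkFinite_of_finite (Finset.finite_toSet T)).closure_eq_closure_of_subset_of_eRk_ge_eRk
          (Finset.coe_subset.2 hTH) (by rw [hrT, hH'.2.2])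
      rw [h1, hH'.2.1.closure]
    simp only [Finset.erase_insert hxT, hcl]
  · rintro ⟨S, x⟩ _
    rfl

/-- A point of `G` outside the closure of a rank-`q` subset of `G` would raise the rank above `rk G = q`: so
every `y ∈ G` lies in the closure of every `S ∈ R_q(G)`. -/
theorem mem_closure_of_mem_Rq {G S : Finset α} {q : ℕ} (hG : G ⊆ gr M)
    (hrG : M.eRk (G : Set α) = (q : ℕ∞)) (hS : S ∈ Rq M G q) {y : α} (hyG : y ∈ G) :
    y ∈ M.closure ((S : Finset α) : Set α) := by
  have hS' := mem_Rq.1 hS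
  have hyE : y ∈ M.E := by
    rw [← coe_gr M, Finset.mem_coe]
    exact hG hyG
  by_contra h
  have h1 : M.eRk (insert y ((S : Finset α) : Set α)) ≤ (q : ℕ∞) := by
    rw [← hrG, ← Finset.coe_insert]
    exact M.eRk_mono (Finset.coe_subset.2 (Finset.insert_subset hyG hS'.1))
  rw [Matroid.eRk_insert_eq_add_one ⟨hyE, h⟩, hS'.2] at h1
  have h2 : q + 1 ≤ q := by exact_mod_cast h1
  omega

/-- The coloops of `S ∪ {y}` (`S ∈ R_q(G)`, `y ∈ G ∖ S`) are the coloops `x` of `S` with `y ∈ cl(S ∖ x)`. -/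
theorem coloopsOf_insert_eq {G S : Finset α} {q : ℕ} (hG : G ⊆ gr M)
    (hrG : M.eRk (G : Set α) = (q : ℕ∞)) (hq : 1 ≤ q) (hS : S ∈ Rq M G q) {y : α}
    (hyG : y ∈ G) (hyS : y ∉ S) :
    coloopsOf M (insert y S) = (coloopsOf M S).filter (fun x => y ∈ clF M (S.erase x)) := by
  have hS' := mem_Rq.1 hS
  ext x
  rw [Finset.mem_filter, mem_coloopsOf, mem_coloopsOf, Finset.mem_insert, mem_clF]
  constructor
  · rintro ⟨hx, hxcl⟩
    rcases hx with rfl | hxS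
    · -- `y` is not a coloop of `S ∪ y`: `y ∈ cl S` already
      exfalso
      rw [Finset.erase_insert hyS] at hxcl
      exact hxcl (mem_closure_of_mem_Rq hG hrG hS hyG)
    · have hne : y ≠ x := fun h' => hyS (h' ▸ hxS)
      rw [Finset.erase_insert_of_ne hne, Finset.coe_insert] at hxcl
      refine ⟨⟨hxS, fun h => hxcl (M.closure_subset_closure (Set.subset_insert _ _) h)⟩, ?_⟩
      -- `y ∈ cl(S ∖ x)`: otherwise `S ∖ x ∪ y` has rank `q` and `x` lies in its closure
      by_contra hy
      apply hxcl
      have hxc : x ∈ coloopsOf M S :=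
        mem_coloopsOf.2 ⟨hxS, fun h => hxcl (M.closure_subset_closure (Set.subset_insert _ _) h)⟩
      have hyE : y ∈ M.E := by
        rw [← coe_gr M, Finset.mem_coe]
        exact hG hyG
      have hxE : x ∈ M.E := by
        rw [← coe_gr M, Finset.mem_coe]
        exact hG (hS'.1 hxS)
      have hr1 : M.eRk (insert y ((S.erase x : Finset α) : Set α)) = (q : ℕ∞) := by
        rw [Matroid.eRk_insert_eq_add_one ⟨hyE, hy⟩, eRk_erase_of_mem_coloopsOf hG hS hxc]
        have : q = (q - 1) + 1 := by omega
        conv_rhs => rw [this]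
        push_cast
        rfl
      by_contra hxcl'
      have h1 : M.eRk (insert x (insert y ((S.erase x : Finset α) : Set α))) ≤ (q : ℕ∞) := by
        rw [← hrG, ← Finset.coe_insert, ← Finset.coe_insert]
        refine M.eRk_mono (Finset.coe_subset.2 ?_)
        exact Finset.insert_subset (hS'.1 hxS)
          (Finset.insert_subset hyG ((Finset.erase_subset x S).trans hS'.1))
      rw [Matroid.eRk_insert_eq_add_one ⟨hxE, hxcl'⟩, hr1] at h1
      have h2 : q + 1 ≤ q := by exact_mod_cast h1
      omega
  · rintro ⟨⟨hxS, hxcl⟩, hy⟩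
    have hne : y ≠ x := fun h' => hyS (h' ▸ hxS)
    refine ⟨Or.inr hxS, ?_⟩
    rw [Finset.erase_insert_of_ne hne, Finset.coe_insert, Matroid.closure_insert_eq_of_mem_closure hy]
    exact hxcl

/-- For `S ∈ R_q(G)` and a coloop `x` of `S`, the points of `G ∖ S` outside the hyperplane `cl(S ∖ x)` are the points
of `G ∖ cl(S ∖ x)` other than `x`: `#{y ∈ G ∖ S : y ∉ cl(S ∖ x)} = |G ∖ cl(S ∖ x)| − 1`. -/
theorem card_sdiff_filter_not_mem_clF_erase {G S : Finset α} {q : ℕ} (hG : G ⊆ gr M) (hS : S ∈ Rq M G q)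
    {x : α} (hx : x ∈ coloopsOf M S) :
    ((G \ S).filter (fun y => y ∉ clF M (S.erase x))).card = (G \ clF M (S.erase x)).card - 1 := by
  have hS' := mem_Rq.1 hS
  have hx' := mem_coloopsOf.1 hx
  have hxcl : x ∉ clF M (S.erase x) := by
    rw [mem_clF]
    exact hx'.2
  have hsub : S.erase x ⊆ clF M (S.erase x) := by
    intro y hy
    rw [mem_clF]
    refine M.subset_closure _ ?_ (Finset.mem_coe.2 hy)
    rw [← coe_gr M]
    exact Finset.coe_subset.2 ((Finset.erase_subset x S).trans (hS'.1.trans hG))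
  have heq : (G \ S).filter (fun y => y ∉ clF M (S.erase x)) = (G \ clF M (S.erase x)).erase x := by
    ext y
    rw [Finset.mem_filter, Finset.mem_sdiff, Finset.mem_erase, Finset.mem_sdiff]
    constructor
    · rintro ⟨⟨hyG, hyS⟩, hycl⟩
      exact ⟨fun h => hyS (h ▸ hx'.1), hyG, hycl⟩
    · rintro ⟨hyx, hyG, hycl⟩
      refine ⟨⟨hyG, fun hyS => hycl (hsub (Finset.mem_erase.2 ⟨hyx, hyS⟩))⟩, hycl⟩
  rw [heq, Finset.card_erase_of_mem]
  rw [Finset.mem_sdiff]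
  exact ⟨hS'.1 hx'.1, hxcl⟩

/-- **(H5)** The rises of the profile are counted by the hyperplane traces: summing `m(S) − m(S ∪ y)` over the
level-`k` sets `S` (`|G ∖ S| = k`) and the points `y ∈ G ∖ S` gives
`Σ_{H ∈ flatsQ (q−1)} |G ∖ H|·(|G ∖ H| − 1)·#{T ⊆ H ∩ G : |T| = |G| − k − 1, rk T = q − 1}`. -/
theorem sum_rises_eq_sum_hyperplanes {G : Finset α} {q k : ℕ} (hG : G ⊆ gr M)
    (hrG : M.eRk (G : Set α) = (q : ℕ∞)) (hq : 1 ≤ q) (hk : k + 1 ≤ G.card) :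
    ∑ S ∈ levelSets M G q k, ∑ y ∈ G \ S, (mTr M S - mTr M (insert y S))
      = ∑ H ∈ flatsQ M (q - 1), (G \ H).card * ((G \ H).card - 1) * spF M G H (q - 1) (G.card - k - 1) := by
  rw [← sum_coloops_weight_eq_sum_hyperplanes hG hq hk]
  refine Finset.sum_congr rfl (fun S hS => ?_)
  have hS' := mem_levelSets.1 hS
  -- per point `y`: the coloops lost are the coloops `x` with `y ∉ cl(S ∖ x)`
  have h1 : ∀ y ∈ G \ S, mTr M S - mTr M (insert y S)
      = ((coloopsOf M S).filter (fun x => y ∉ clF M (S.erase x))).card := by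
    intro y hy
    rw [Finset.mem_sdiff] at hy
    unfold mTr
    rw [coloopsOf_insert_eq hG hrG hq hS'.1 hy.1 hy.2]
    have h2 := Finset.card_filter_add_card_filter_not (s := coloopsOf M S)
      (p := fun x => y ∈ clF M (S.erase x))
    omega
  rw [Finset.sum_congr rfl h1]
  -- swap the two sums
  simp only [Finset.card_filter]
  rw [Finset.sum_comm]
  refine Finset.sum_congr rfl (fun x hx => ?_)
  rw [← Finset.card_filter, card_sdiff_filter_not_mem_clF_erase hG hS'.1 hx]


/-! ## The stays: `m(S ∪ y) = m(S)` exactly when `y` lies in the closure of the cyclic part of `S` -/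

/-- A coloop of `S` lies outside the closure of the cyclic part `S ∖ coloops`. -/
theorem not_mem_clF_sdiff_coloopsOf {S : Finset α} {x : α} (hx : x ∈ coloopsOf M S) :
    x ∉ clF M (S \ coloopsOf M S) := by
  have hx' := mem_coloopsOf.1 hx
  rw [mem_clF]
  intro h
  apply hx'.2
  refine M.closure_subset_closure (Finset.coe_subset.2 ?_) h
  intro z hz
  rw [Finset.mem_sdiff] at hz
  rw [Finset.mem_erase]
  exact ⟨fun h' => hz.2 (h' ▸ hx), hz.1⟩

/-- **The stays.** For `S ∈ R_q(G)` and `y ∈ G ∖ S`: `m(S ∪ y) = m(S)` iff `y ∈ cl(S ∖ coloops)` — every coloop of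
`S` survives iff `y` lies in every coloop hyperplane, i.e. in the closure of the cyclic part. -/
theorem mTr_insert_eq_iff {G S : Finset α} {q : ℕ} (hG : G ⊆ gr M)
    (hrG : M.eRk (G : Set α) = (q : ℕ∞)) (hq : 1 ≤ q) (hS : S ∈ Rq M G q) {y : α}
    (hyG : y ∈ G) (hyS : y ∉ S) :
    mTr M (insert y S) = mTr M S ↔ y ∈ clF M (S \ coloopsOf M S) := by
  have hS' := mem_Rq.1 hS
  have hyE : y ∈ M.E := by
    rw [← coe_gr M, Finset.mem_coe]
    exact hG hyG
  have hcol := coloopsOf_insert_eq hG hrG hq hS hyG hyS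
  have hZ : (insert y S \ coloopsOf M S : Finset α) = insert y (S \ coloopsOf M S) := by
    ext z
    rw [Finset.mem_sdiff, Finset.mem_insert, Finset.mem_insert, Finset.mem_sdiff]
    constructor
    · rintro ⟨h1 | h1, h2⟩
      · exact Or.inl h1
      · exact Or.inr ⟨h1, h2⟩
    · rintro (rfl | ⟨h1, h2⟩)
      · exact ⟨Or.inl rfl, fun h => hyS ((coloopsOf_subset S) h)⟩
      · exact ⟨Or.inr h1, h2⟩
  constructor
  · -- every coloop survives ⇒ the cyclic part of `S ∪ y` is `Z ∪ y` of rank `q − m = rk Z` ⇒ `y ∈ cl Z`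
    intro hm
    have hfull : coloopsOf M (insert y S) = coloopsOf M S := by
      rw [hcol]
      exact Finset.eq_of_subset_of_card_le (Finset.filter_subset _ _) (by unfold mTr at hm; rw [← hcol]; exact le_of_eq hm.symm)
    have h1 := eRk_sdiff_coloopsOf_add_mTr hG (insert_mem_Rq hrG hS hyG)
    have h2 := eRk_sdiff_coloopsOf_add_mTr hG hS
    rw [hfull, hZ, hm] at h1
    rw [mem_clF]
    by_contra hy
    rw [Finset.coe_insert, Matroid.eRk_insert_eq_add_one ⟨hyE, hy⟩] at h1
    obtain ⟨a, ha⟩ := exists_eRk_eq_nat (M := M) (S \ coloopsOf M S)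
    rw [ha] at h1 h2
    have h3 : a + 1 + mTr M S = q := by exact_mod_cast h1
    have h4 : a + mTr M S = q := by exact_mod_cast h2
    omega
  · intro hy
    unfold mTr
    rw [hcol]
    congr 1
    refine Finset.filter_true_of_mem (fun x hx => ?_)
    rw [mem_clF] at hy ⊢
    refine M.closure_subset_closure (Finset.coe_subset.2 ?_) hy
    intro z hz
    rw [Finset.mem_sdiff] at hz
    rw [Finset.mem_erase]
    exact ⟨fun h' => hz.2 (h' ▸ hx), hz.1⟩

/-- **(ST)** The stays of `S`: the points `y ∈ G ∖ S` with `m(S ∪ y) = m(S)` number `|cl(Z) ∩ G| − |Z|`, `Z` the cyclic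
part of `S` (the trace of the flat of the cyclic part, minus the cyclic part itself). -/
theorem card_stays_eq {G S : Finset α} {q : ℕ} (hG : G ⊆ gr M)
    (hrG : M.eRk (G : Set α) = (q : ℕ∞)) (hq : 1 ≤ q) (hS : S ∈ Rq M G q) :
    ((G \ S).filter (fun y => mTr M (insert y S) = mTr M S)).card
      = (clF M (S \ coloopsOf M S) ∩ G).card - (S \ coloopsOf M S).card := by
  have hS' := mem_Rq.1 hS
  have heq : (G \ S).filter (fun y => mTr M (insert y S) = mTr M S)
      = (clF M (S \ coloopsOf M S) ∩ G) \ (S \ coloopsOf M S) := by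
    ext y
    rw [Finset.mem_filter, Finset.mem_sdiff, Finset.mem_sdiff, Finset.mem_inter, Finset.mem_sdiff]
    constructor
    · rintro ⟨⟨hyG, hyS⟩, hm⟩
      exact ⟨⟨(mTr_insert_eq_iff hG hrG hq hS hyG hyS).1 hm, hyG⟩, fun h => hyS h.1⟩
    · rintro ⟨⟨hycl, hyG⟩, hyZ⟩
      have hyS : y ∉ S := by
        intro hyS
        by_cases hyc : y ∈ coloopsOf M S
        · exact not_mem_clF_sdiff_coloopsOf hyc hycl
        · exact hyZ ⟨hyS, hyc⟩
      exact ⟨⟨hyG, hyS⟩, (mTr_insert_eq_iff hG hrG hq hS hyG hyS).2 hycl⟩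
  rw [heq, Finset.card_sdiff_of_subset]
  intro z hz
  rw [Finset.mem_sdiff] at hz
  rw [Finset.mem_inter]
  refine ⟨?_, hS'.1 hz.1⟩
  rw [mem_clF]
  refine M.subset_closure _ ?_ (Finset.mem_coe.2 (Finset.mem_sdiff.2 hz))
  rw [← coe_gr M]
  exact Finset.coe_subset.2 ((Finset.sdiff_subset).trans (hS'.1.trans hG))

end PercRepro.Night4
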